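import Summits.QuantumFields.YangMills.Theorems.BalabanUVNodesN15KingModelPotentialDressedPropagatorRun

/-!
# N15 (NE2⁺), King-model rung, part 17: the dressed fluctuation propagator's two-spacing rate WITH DECAY

Cell `pub-ymgap-dag-n15-d` (R134 acceleration DAG, node N15 = NE2, strategy s3 KING-MODEL RUNG), part 17 — the weighted twin of parts 13a ∕ 13b.
Part 13a (`…PotentialDressedPropagator`) bounded the Riemann-sum two-spacing rate of the dressed fluctuation propagator `G_w = N^{d+1}(A₀ + diag w)⁻¹`
WITHOUT a decay weight; its weighted mass (`dressedProp_riemannMassW_le`) and parts 11a ∕ 11b (weighted Riemann mass and rate of King's `G`) supply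
everything the same ℓ^∞-operator step needs WITH the weight `e^{δ′|B x′ − B y′|}`:

* §1 `weighted_kernel3_le` — the weighted telescoping of `G′w′h′ − Gwh` with the weight split through the middle block (real arithmetic);
* §2 ★★ `dressedProp_riemannRateW_le` — two runs `L^k`, `L·L^k`; letters: `C_W ≥` the WEIGHTED undressed Riemann masses (both runs), `R ≥` the WEIGHTED
  undressed two-spacing rate, `|w|, |w′| ≤ w₀`, coherence `ν`, window `C_W·w₀ ≤ 1∕2`, `δ′ ≥ 0`; then at every fine `x′`
  `Σ_{y′} N′^{−(d+1)}|G′_{w′}(x′, y′) − G_w(x, y)|·e^{δ′|B x′ − B y′|} ≤ 2(R + R·w₀·2C_W + C_W·ν·2C_W)` (`x, y` under `x′, y′`);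
* §3 ★★ `dressedProp_rateW_kingU` — along King's run (`a_k`, `c = N²`, King-admissible tori), uniformly in the potential tower inside the window and under
  the coherence letter: `∃ w̄ δ c > 0 ∀ … ∀ k ≥ 1 ∀ 0 ≤ δ′ ≤ δ ∀ x′`,
  `N′^{−(d+1)}Σ_{y′}|G_{k+1,v}(x′, y′) − G_{k,v}(x, y)|·e^{δ′|Bx′ − By′|} ≤ c((L^{−1∕2})^k + ν₀s^k)` — the scalar model's (3.36)-type letter of the
  background-dependent fluctuation propagator WITH the (2.13)-type decay, the form a fine-lattice operator layer consumes.

HONEST SCOPE.  King's A = 0 scalar model on King-admissible tori, odd `L ≥ 3`, `a, m² > 0`; scalar potentials, not gauge fields; Riemann-sum (row-averaged)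
statements, not pointwise kernel bounds; count-neutral (`--supports`), not a discharge of N15, nothing in `YMDAG.*` touched.

References: C. King, Commun. Math. Phys. 103 (1986) 323–349, (2.13) p.653, Thm 3.3 (3.7) p.658, Prop. 3.8 (3.71) p.664 (bib key `King1986`); [B9] =
Bałaban, Commun. Math. Phys. 102 (1985) 385–462, (3.35)–(3.36) p.396 (bib key `Balaban1985BackgroundPropagators`).
-/

noncomputable section
open scoped BigOperators Matrix
open Finset

namespace Summit.QuantumFields.YangMills.BalabanUVNodes.N15.KingModel

open Literature.MathematicalPhysics.QuantumFieldTheory.Balaban1983to89 hiding blockOf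
open Literature.MathematicalPhysics.QuantumFieldTheory.Balaban1983to89.B5Prop11Plancherel (Tor fine)
open Literature.MathematicalPhysics.QuantumFieldTheory.King1986 (aK aK_pos)
open Literature.MathematicalPhysics.QuantumFieldTheory.King1986.Torus
open Summit.QuantumFields.YangMills.BalabanUVNodes.N15KingModelRung.Curved (underPtN val_underPtN blockOf_underPtN)

variable {d : ℕ}

/-! ## §1 Weighted telescoping -/

/-- Weighted telescoping of a triple product with the weight split through the middle index: if `wz ≤ ez·wy`, `|w′|, |w| ≤ w₀`, `|w′ − w| ≤ ν` then
`|G′w′h′ − Gwh|·wz ≤ |G′ − G|·ez·(w₀(|h′|wy)) + |G|·ez·(ν(|h′|wy) + w₀(|h′ − h|wy))`. [folklore] -/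
theorem weighted_kernel3_le {G G' w w' h h' wz ez wy w₀ ν : ℝ} (hwz : 0 ≤ wz) (hez : 0 ≤ ez) (hwy : 0 ≤ wy)
    (h1 : |w'| ≤ w₀) (h2 : |w| ≤ w₀) (h3 : |w' - w| ≤ ν) (h6 : wz ≤ ez * wy) :
    |G' * w' * h' - G * w * h| * wz
      ≤ |G' - G| * ez * (w₀ * (|h'| * wy)) + |G| * ez * (ν * (|h'| * wy) + w₀ * (|h' - h| * wy)) := by
  have htel := abs_kernel3_sub_le G G' w w' h h'
  calc |G' * w' * h' - G * w * h| * wz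
      ≤ (|G' - G| * |w'| * |h'| + |G| * (|w' - w| * |h'| + |w| * |h' - h|)) * (ez * wy) :=
        mul_le_mul htel h6 hwz (by positivity)
    _ = |G' - G| * ez * (|w'| * (|h'| * wy)) + |G| * ez * (|w' - w| * (|h'| * wy) + |w| * (|h' - h| * wy)) := by ring
    _ ≤ |G' - G| * ez * (w₀ * (|h'| * wy)) + |G| * ez * (ν * (|h'| * wy) + w₀ * (|h' - h| * wy)) := by
        have a1 : |w'| * (|h'| * wy) ≤ w₀ * (|h'| * wy) := mul_le_mul_of_nonneg_right h1 (by positivity)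
        have a2 : |w' - w| * (|h'| * wy) ≤ ν * (|h'| * wy) := mul_le_mul_of_nonneg_right h3 (by positivity)
        have a3 : |w| * (|h' - h| * wy) ≤ w₀ * (|h' - h| * wy) := mul_le_mul_of_nonneg_right h2 (by positivity)
        have b1 := mul_le_mul_of_nonneg_left a1 (by positivity : 0 ≤ |G' - G| * ez)
        have b2 := mul_le_mul_of_nonneg_left (add_le_add a2 a3) (by positivity : 0 ≤ |G| * ez)
        linarith

/-! ## §2 The weighted two-spacing rate of the dressed propagator -/

section RateW

variable (L : ℕ) [NeZero L] {U : Fin (d + 1) → ℕ} [∀ μ, NeZero (U μ)] {a m2 : ℝ}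

/-- **THE WEIGHTED RIEMANN-SUM TWO-SPACING RATE OF THE DRESSED PROPAGATOR** (the scalar model's (3.36)-type letter for `G_{k,w}` WITH decay).  Two runs
`L^k`, `L·L^k` over `U` with King's coefficients and potentials `w, w′`; letters: `C_W ≥` the undressed WEIGHTED Riemann masses at rate `δ′ ≥ 0` (both runs,
part 11a), `R ≥` the undressed WEIGHTED two-spacing rate (part 11b), `|w|, |w′| ≤ w₀`, coherence `|w′(z′) − w(z)| ≤ ν`, window `C_W·w₀ ≤ 1∕2`.  Then
`Σ_{y′} N′^{−(d+1)}|G′_{w′}(x′, y′) − G_w(x, y)|·e^{δ′|Bx′ − By′|} ≤ 2(R + R·w₀·(2C_W) + C_W·ν·(2C_W))` at every `x′` — part 13a's proof with the weight split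
through the middle block (`e^{δ′|Bx′−By′|} ≤ e^{δ′|Bx′−Bu′|}e^{δ′|Bu′−By′|}`). [cite: King1986, (2.13) p.653, Prop. 3.8 (3.71) p.664, p.664 (pairing); Balaban1985BackgroundPropagators, (3.36) p.396 (slot)] -/
theorem dressedProp_riemannRateW_le {k : ℕ} (hak : 0 ≤ aK a L k) (hak' : 0 ≤ aK a L (k + 1)) (hm : 0 < m2)
    {w : Tor (fine (L ^ k) U) → ℝ} {w' : Tor (fine (L ^ 1 * L ^ k) U) → ℝ}
    (hB : IsUnit (fineOpPot (L ^ k) U (aK a L k) (((L ^ k : ℕ) : ℝ) ^ 2) m2 w))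
    (hB' : IsUnit (fineOpPot (L ^ 1 * L ^ k) U (aK a L (k + 1)) (((L ^ 1 * L ^ k : ℕ) : ℝ) ^ 2) m2 w'))
    {CW R w₀ ν δ' : ℝ} (hCW : 0 ≤ CW) (hR : 0 ≤ R) (hδ' : 0 ≤ δ')
    (hmassW : ∀ x : Tor (fine (L ^ k) U),
      (((L ^ k : ℕ) : ℝ) ^ (d + 1))⁻¹ * ∑ y, |constrainedProp (L ^ k) U (aK a L k) (((L ^ k : ℕ) : ℝ) ^ 2) m2 x y|
        * Real.exp (δ' * tdistT U (blockOf (L ^ k) U x) (blockOf (L ^ k) U y)) ≤ CW)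
    (hmassW' : ∀ x' : Tor (fine (L ^ 1 * L ^ k) U),
      (((L ^ 1 * L ^ k : ℕ) : ℝ) ^ (d + 1))⁻¹ *
        ∑ y', |constrainedProp (L ^ 1 * L ^ k) U (aK a L (k + 1)) (((L ^ 1 * L ^ k : ℕ) : ℝ) ^ 2) m2 x' y'|
          * Real.exp (δ' * tdistT U (blockOf (L ^ 1 * L ^ k) U x') (blockOf (L ^ 1 * L ^ k) U y')) ≤ CW)
    (hrateW : ∀ x' : Tor (fine (L ^ 1 * L ^ k) U),
      (((L ^ 1 * L ^ k : ℕ) : ℝ) ^ (d + 1))⁻¹ *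
          ∑ y', |constrainedProp (L ^ 1 * L ^ k) U (aK a L (k + 1)) (((L ^ 1 * L ^ k : ℕ) : ℝ) ^ 2) m2 x' y'
            - constrainedProp (L ^ k) U (aK a L k) (((L ^ k : ℕ) : ℝ) ^ 2) m2 (underPtN L k 1 U x') (underPtN L k 1 U y')|
            * Real.exp (δ' * tdistT U (blockOf (L ^ 1 * L ^ k) U x') (blockOf (L ^ 1 * L ^ k) U y')) ≤ R)
    (hw : ∀ y, |w y| ≤ w₀) (hw' : ∀ y', |w' y'| ≤ w₀) (hcoh : ∀ y', |w' y' - w (underPtN L k 1 U y')| ≤ ν)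
    (hwin : CW * w₀ ≤ 1 / 2) (x' : Tor (fine (L ^ 1 * L ^ k) U)) :
    (((L ^ 1 * L ^ k : ℕ) : ℝ) ^ (d + 1))⁻¹ *
        ∑ y', |dressedProp (L ^ 1 * L ^ k) U (aK a L (k + 1)) m2 (((L ^ 1 * L ^ k : ℕ) : ℝ) ^ 2) w' x' y'
          - dressedProp (L ^ k) U (aK a L k) m2 (((L ^ k : ℕ) : ℝ) ^ 2) w (underPtN L k 1 U x') (underPtN L k 1 U y')|
          * Real.exp (δ' * tdistT U (blockOf (L ^ 1 * L ^ k) U x') (blockOf (L ^ 1 * L ^ k) U y'))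
      ≤ 2 * (R + R * (w₀ * (2 * CW)) + CW * (ν * (2 * CW))) := by
  have hw₀ : 0 ≤ w₀ := nonneg_of_abs_le hw
  have hν : 0 ≤ ν := (abs_nonneg _).trans (hcoh fun _ => 0)
  have hA : IsUnit (fineOp (L ^ k) U (aK a L k) (((L ^ k : ℕ) : ℝ) ^ 2) m2) := fineOp_isUnit _ U hak (by positivity) hm
  have hA' : IsUnit (fineOp (L ^ 1 * L ^ k) U (aK a L (k + 1)) (((L ^ 1 * L ^ k : ℕ) : ℝ) ^ 2) m2) := fineOp_isUnit _ U hak' (by positivity) hm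
  have hN'pos : (0 : ℝ) < (((L ^ 1 * L ^ k : ℕ) : ℝ)) ^ (d + 1) := pow_pos (Nat.cast_pos.mpr (Nat.pos_of_ne_zero (NeZero.ne _))) _
  set μ : ℝ := ((((L ^ 1 * L ^ k : ℕ) : ℝ)) ^ (d + 1))⁻¹ with hμdef
  have hμ0 : 0 ≤ μ := inv_nonneg.mpr hN'pos.le
  set G := constrainedProp (L ^ k) U (aK a L k) (((L ^ k : ℕ) : ℝ) ^ 2) m2 with hGdef
  set G' := constrainedProp (L ^ 1 * L ^ k) U (aK a L (k + 1)) (((L ^ 1 * L ^ k : ℕ) : ℝ) ^ 2) m2 with hG'def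
  set Gw := dressedProp (L ^ k) U (aK a L k) m2 (((L ^ k : ℕ) : ℝ) ^ 2) w with hGwdef
  set Gw' := dressedProp (L ^ 1 * L ^ k) U (aK a L (k + 1)) m2 (((L ^ 1 * L ^ k : ℕ) : ℝ) ^ 2) w' with hGw'def
  -- the weight on the fine lattice and its split through a middle block
  set E : Tor (fine (L ^ 1 * L ^ k) U) → Tor (fine (L ^ 1 * L ^ k) U) → ℝ := fun a' b' =>
    Real.exp (δ' * tdistT U (blockOf (L ^ 1 * L ^ k) U a') (blockOf (L ^ 1 * L ^ k) U b')) with hEdef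
  have hE0 : ∀ a' b', 0 ≤ E a' b' := fun a' b' => Real.exp_nonneg _
  have hEsplit : ∀ a' u' b', E a' b' ≤ E a' u' * E u' b' := fun a' u' b' => exp_weight_split hδ' _ _ _
  -- the dressed fine WEIGHTED mass `≤ 2C_W` (part 13a)
  have hMw' : ∀ z', μ * ∑ y', |Gw' z' y'| * E z' y' ≤ 2 * CW := fun z' =>
    dressedProp_riemannMassW_le hA' hB' hCW hδ' hmassW' hw' hwin z'
  -- the weighted row defect and the ℓ^∞ step
  set f : Tor (fine (L ^ 1 * L ^ k) U) → ℝ := fun z' =>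
    μ * ∑ y', |Gw' z' y' - Gw (underPtN L k 1 U z') (underPtN L k 1 U y')| * E z' y' with hfdef
  refine sup_bound_of_affine f (by positivity) hwin (fun S hS z' => ?_) x'
  have hS0 : 0 ≤ S := le_trans (by rw [hfdef]; exact mul_nonneg hμ0 (sum_nonneg fun y' _ => mul_nonneg (abs_nonneg _) (hE0 _ _))) (hS z')
  set z := underPtN L k 1 U z' with hzdef
  -- entrywise, weighted: subtract the two fixed points, move the coarse middle sum to the finer lattice, telescope with the weight split
  have hentry : ∀ y', |Gw' z' y' - Gw z (underPtN L k 1 U y')| * E z' y'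
      ≤ |G' z' y' - G z (underPtN L k 1 U y')| * E z' y'
        + μ * ∑ u', (|G' z' u' - G z (underPtN L k 1 U u')| * E z' u' * (w₀ * (|Gw' u' y'| * E u' y'))
          + |G z (underPtN L k 1 U u')| * E z' u' * (ν * (|Gw' u' y'| * E u' y')
            + w₀ * (|Gw' u' y' - Gw (underPtN L k 1 U u') (underPtN L k 1 U y')| * E u' y'))) := by
    intro y'
    have hfine : Gw' z' y' = G' z' y' - μ * ∑ u', G' z' u' * w' u' * Gw' u' y' := dressedProp_fixedPoint hA' hB' z' y'
    have hcoarse : Gw z (underPtN L k 1 U y') = G z (underPtN L k 1 U y')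
        - (((L ^ k : ℕ) : ℝ) ^ (d + 1))⁻¹ * ∑ u, G z u * w u * Gw u (underPtN L k 1 U y') := dressedProp_fixedPoint hA hB z _
    have hmove : (((L ^ k : ℕ) : ℝ) ^ (d + 1))⁻¹ * ∑ u, G z u * w u * Gw u (underPtN L k 1 U y')
        = μ * ∑ u', G z (underPtN L k 1 U u') * w (underPtN L k 1 U u') * Gw (underPtN L k 1 U u') (underPtN L k 1 U y') :=
      (avg_comp_underPtN L U k (fun u => G z u * w u * Gw u (underPtN L k 1 U y'))).symm
    have hdiff : Gw' z' y' - Gw z (underPtN L k 1 U y') = (G' z' y' - G z (underPtN L k 1 U y'))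
        - μ * ∑ u', (G' z' u' * w' u' * Gw' u' y'
          - G z (underPtN L k 1 U u') * w (underPtN L k 1 U u') * Gw (underPtN L k 1 U u') (underPtN L k 1 U y')) := by
      rw [hfine, hcoarse, hmove, sum_sub_distrib, mul_sub]
      ring
    rw [hdiff]
    have hEy := hE0 z' y'
    calc |G' z' y' - G z (underPtN L k 1 U y') - μ * ∑ u', (G' z' u' * w' u' * Gw' u' y'
            - G z (underPtN L k 1 U u') * w (underPtN L k 1 U u') * Gw (underPtN L k 1 U u') (underPtN L k 1 U y'))| * E z' y'
        ≤ (|G' z' y' - G z (underPtN L k 1 U y')| + μ * ∑ u', |G' z' u' * w' u' * Gw' u' y'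
            - G z (underPtN L k 1 U u') * w (underPtN L k 1 U u') * Gw (underPtN L k 1 U u') (underPtN L k 1 U y')|) * E z' y' := by
          refine mul_le_mul_of_nonneg_right ((abs_sub _ _).trans (add_le_add le_rfl ?_)) hEy
          rw [abs_mul, abs_of_nonneg hμ0]
          exact mul_le_mul_of_nonneg_left (abs_sum_le_sum_abs _ _) hμ0
      _ = |G' z' y' - G z (underPtN L k 1 U y')| * E z' y' + μ * ∑ u', |G' z' u' * w' u' * Gw' u' y'
            - G z (underPtN L k 1 U u') * w (underPtN L k 1 U u') * Gw (underPtN L k 1 U u') (underPtN L k 1 U y')| * E z' y' := by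
          rw [add_mul, mul_assoc, sum_mul]
      _ ≤ _ := by
          refine add_le_add le_rfl (mul_le_mul_of_nonneg_left (sum_le_sum fun u' _ => ?_) hμ0)
          exact weighted_kernel3_le (hE0 z' y') (hE0 z' u') (hE0 u' y') (hw' u') (hw _) (hcoh u') (hEsplit z' u' y')
  -- sum over `y′`, exchange the two sums, use the dressed weighted mass and `f ≤ S` inside
  have hswap := sum_sum_affine_comm (ι := Tor (fine (L ^ 1 * L ^ k) U)) (κ := Tor (fine (L ^ 1 * L ^ k) U))
    (fun u' => |G' z' u' - G z (underPtN L k 1 U u')| * E z' u') (fun u' => |G z (underPtN L k 1 U u')| * E z' u')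
    (fun u' y' => |Gw' u' y'| * E u' y') (fun u' y' => |Gw' u' y' - Gw (underPtN L k 1 U u') (underPtN L k 1 U y')| * E u' y') w₀ ν w₀
  have hfu : ∀ u', μ * ∑ y', |Gw' u' y' - Gw (underPtN L k 1 U u') (underPtN L k 1 U y')| * E u' y' = f u' := fun u' => rfl
  -- the coarse weighted mass read on the finer lattice (blocks of under-points are the blocks)
  have hmoveAbs : μ * ∑ u', |G z (underPtN L k 1 U u')| * E z' u'
      = (((L ^ k : ℕ) : ℝ) ^ (d + 1))⁻¹ * ∑ u, |G z u| * Real.exp (δ' * tdistT U (blockOf (L ^ k) U z) (blockOf (L ^ k) U u)) := by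
    rw [← avg_comp_underPtN L U k (fun u => |G z u| * Real.exp (δ' * tdistT U (blockOf (L ^ k) U z) (blockOf (L ^ k) U u)))]
    refine congrArg _ (sum_congr rfl fun u' _ => ?_)
    simp only [hEdef, hzdef, blockOf_underPtN]
  show f z' ≤ R + R * (w₀ * (2 * CW)) + CW * (ν * (2 * CW)) + CW * w₀ * S
  calc f z' = μ * ∑ y', |Gw' z' y' - Gw z (underPtN L k 1 U y')| * E z' y' := rfl
    _ ≤ μ * ∑ y', (|G' z' y' - G z (underPtN L k 1 U y')| * E z' y'
          + μ * ∑ u', (|G' z' u' - G z (underPtN L k 1 U u')| * E z' u' * (w₀ * (|Gw' u' y'| * E u' y'))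
            + |G z (underPtN L k 1 U u')| * E z' u' * (ν * (|Gw' u' y'| * E u' y')
              + w₀ * (|Gw' u' y' - Gw (underPtN L k 1 U u') (underPtN L k 1 U y')| * E u' y')))) :=
        mul_le_mul_of_nonneg_left (sum_le_sum fun y' _ => hentry y') hμ0
    _ = μ * ∑ y', |G' z' y' - G z (underPtN L k 1 U y')| * E z' y'
        + μ * ∑ u', (|G' z' u' - G z (underPtN L k 1 U u')| * E z' u' * (w₀ * (μ * ∑ y', |Gw' u' y'| * E u' y'))
          + |G z (underPtN L k 1 U u')| * E z' u' * (ν * (μ * ∑ y', |Gw' u' y'| * E u' y') + w₀ * f u')) := by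
        have key : μ * ∑ y', μ * ∑ u', (|G' z' u' - G z (underPtN L k 1 U u')| * E z' u' * (w₀ * (|Gw' u' y'| * E u' y'))
              + |G z (underPtN L k 1 U u')| * E z' u' * (ν * (|Gw' u' y'| * E u' y')
                + w₀ * (|Gw' u' y' - Gw (underPtN L k 1 U u') (underPtN L k 1 U y')| * E u' y')))
            = μ * ∑ u', (|G' z' u' - G z (underPtN L k 1 U u')| * E z' u' * (w₀ * (μ * ∑ y', |Gw' u' y'| * E u' y'))
              + |G z (underPtN L k 1 U u')| * E z' u' * (ν * (μ * ∑ y', |Gw' u' y'| * E u' y') + w₀ * f u')) := by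
          rw [← mul_sum, hswap, mul_sum]
          refine congrArg _ (sum_congr rfl fun u' _ => ?_)
          rw [← hfu u']
          ring
        rw [sum_add_distrib, mul_add, key]
    _ ≤ R + μ * ∑ u', (|G' z' u' - G z (underPtN L k 1 U u')| * E z' u' * (w₀ * (2 * CW))
          + |G z (underPtN L k 1 U u')| * E z' u' * (ν * (2 * CW) + w₀ * S)) := by
        refine add_le_add (hrateW z') (mul_le_mul_of_nonneg_left (sum_le_sum fun u' _ => add_le_add ?_ ?_) hμ0)
        · exact mul_le_mul_of_nonneg_left (mul_le_mul_of_nonneg_left (hMw' u') hw₀) (mul_nonneg (abs_nonneg _) (hE0 _ _))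
        · exact mul_le_mul_of_nonneg_left (add_le_add (mul_le_mul_of_nonneg_left (hMw' u') hν)
            (mul_le_mul_of_nonneg_left (hS u') hw₀)) (mul_nonneg (abs_nonneg _) (hE0 _ _))
    _ = R + (μ * ∑ u', |G' z' u' - G z (underPtN L k 1 U u')| * E z' u') * (w₀ * (2 * CW))
          + (μ * ∑ u', |G z (underPtN L k 1 U u')| * E z' u') * (ν * (2 * CW) + w₀ * S) := by
        rw [sum_add_distrib, mul_add, ← sum_mul, ← sum_mul]
        ring
    _ ≤ R + R * (w₀ * (2 * CW)) + CW * (ν * (2 * CW) + w₀ * S) := by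
        have h1 := hrateW z'
        have h2 : μ * ∑ u', |G z (underPtN L k 1 U u')| * E z' u' ≤ CW := by rw [hmoveAbs]; exact hmassW z
        have h3 := mul_le_mul_of_nonneg_right h1 (by positivity : 0 ≤ w₀ * (2 * CW))
        have h4 := mul_le_mul_of_nonneg_right h2 (by positivity : 0 ≤ ν * (2 * CW) + w₀ * S)
        linarith
    _ = R + R * (w₀ * (2 * CW)) + CW * (ν * (2 * CW)) + CW * w₀ * S := by ring

end RateW

/-! ## §3 Along King's run: the (3.36)-type letter of `G_{k,v}` WITH decay -/

section Run

open Real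

variable (L : ℕ) [NeZero L]

/-- **THE (3.36)-TYPE LETTER OF THE DRESSED FLUCTUATION PROPAGATOR WITH DECAY, ALONG KING'S RUN.**  For odd `L ≥ 3`, `a, m² > 0` there are
`w̄, δ, c > 0` such that for every volume exponent `e`, every potential tower `v` with `sup|v_N| ≤ w₀ ≤ w̄`, `0 ≤ ν₀`, `0 ≤ s ≤ L^{−1∕2}`, coherence
`|v_{L·L^k}(x′) − v_{L^k}(x)| ≤ ν₀s^k` (`k ≥ 1`), every `k ≥ 1`, every `0 ≤ δ′ ≤ δ` and every `x′`:
`N′^{−(d+1)}Σ_{y′}|G_{k+1,v}(x′, y′) − G_{k,v}(x, y)|·e^{δ′|Bx′ − By′|} ≤ c((L^{−1∕2})^k + ν₀s^k)` (`x, y` under `x′, y′`;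
`G_{k,v} = dressedProp (L^k) U (a_k) m² ((L^k)²) (v_{L^k})`) — §2 on parts 11a (weighted masses, both runs) and 11b (weighted rate, `γ = 1`) in
part 9c's window. [cite: King1986, (2.13) p.653, Prop. 3.8 (3.71) p.664; Balaban1985BackgroundPropagators, (3.36) p.396 (slot)] -/
theorem dressedProp_rateW_kingU (hLodd : Odd L) (hL : 2 ≤ L) {a m2 : ℝ} (ha : 0 < a) (hm : 0 < m2) :
    ∃ wb δ c : ℝ, 0 < wb ∧ 0 < δ ∧ 0 < c ∧ ∀ (e : ℕ) (v : ∀ N : ℕ, Tor (fine N (kingU d L e)) → ℝ) (w₀ ν₀ s : ℝ),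
      (∀ (N : ℕ) (x : Tor (fine N (kingU d L e))), |v N x| ≤ w₀) → w₀ ≤ wb → 0 ≤ ν₀ → 0 ≤ s → s ≤ (L : ℝ) ^ (-(1 / 2 : ℝ)) →
      (∀ (k : ℕ), 1 ≤ k → ∀ x' : Tor (fine (L ^ 1 * L ^ k) (kingU d L e)),
          |v (L ^ 1 * L ^ k) x' - v (L ^ k) (underPtN L k 1 (kingU d L e) x')| ≤ ν₀ * s ^ k) →
      ∀ (k : ℕ), 1 ≤ k → ∀ (δ' : ℝ), 0 ≤ δ' → δ' ≤ δ → ∀ x' : Tor (fine (L ^ 1 * L ^ k) (kingU d L e)),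
        (((L ^ 1 * L ^ k : ℕ) : ℝ) ^ (d + 1))⁻¹ *
            ∑ y', |dressedProp (L ^ 1 * L ^ k) (kingU d L e) (aK a L (k + 1)) m2 (((L ^ 1 * L ^ k : ℕ) : ℝ) ^ 2) (v (L ^ 1 * L ^ k)) x' y'
              - dressedProp (L ^ k) (kingU d L e) (aK a L k) m2 (((L ^ k : ℕ) : ℝ) ^ 2) (v (L ^ k))
                  (underPtN L k 1 (kingU d L e) x') (underPtN L k 1 (kingU d L e) y')|
              * Real.exp (δ' * tdistT (kingU d L e) (blockOf (L ^ 1 * L ^ k) (kingU d L e) x') (blockOf (L ^ 1 * L ^ k) (kingU d L e) y'))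
          ≤ c * (((L : ℝ) ^ (-(1 / 2 : ℝ))) ^ k + ν₀ * s ^ k) := by
  have hL1 : 1 < L := by omega
  have hLr : (1 : ℝ) < L := by exact_mod_cast hL1
  -- the weighted Riemann constants of the undressed propagator (parts 11a, 11b) and the window of 9c
  obtain ⟨δW, CW, hδW, hCW, HW⟩ := fullProp_riemannMassW_unif (d := d) L hLodd hL ha hm.le
  obtain ⟨δR, CR, hδR, hCR, HR⟩ := fullProp_riemannRateW_unif (d := d) L hLodd hL ha hm.le (γ := 1) zero_le_one le_rfl
  obtain ⟨-, -, hwbar⟩ := dressedConsts_nonneg (d := d) ha hL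
  set wb : ℝ := min (wbarK (d + 1) a L) (1 / (2 * CW)) with hwbdef
  have hwb : 0 < wb := lt_min hwbar (by positivity)
  set c : ℝ := 4 * CR + 4 * CW ^ 2 + 1 with hcdef
  have hc : 0 < c := by positivity
  refine ⟨wb, min δW δR, c, hwb, lt_min hδW hδR, hc, fun e v w₀ ν₀ s hv hw hν₀ hs0 hs1 hcoh k hk1 δ' hδ0 hδ1 x' => ?_⟩
  have hδ1W : δ' ≤ δW := hδ1.trans (min_le_left _ _)
  have hδ1R : δ' ≤ δR := hδ1.trans (min_le_right _ _)
  set r : ℝ := (L : ℝ) ^ (-(1 / 2 : ℝ)) with hrdef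
  have hr0 : 0 ≤ r := Real.rpow_nonneg (Nat.cast_nonneg _) _
  have hw₀ : 0 ≤ w₀ := (abs_nonneg _).trans (hv 0 fun _ => 0)
  have hM' : ∀ μ, kingU d L e μ = 2 * L ^ (e + 1) := fun μ => by
    show L * (2 * L ^ e) = 2 * L ^ (e + 1)
    ring
  have hN' : L ^ 1 * L ^ k = L ^ (k + 1) := by ring
  have hak : 0 < aK a L k := aK_pos ha hLr hk1
  have hak' : 0 < aK a L (k + 1) := aK_pos ha hLr (by omega)
  -- the window and the invertibility of the two runs' operators
  have hwbar' : w₀ ≤ wbarK (d + 1) a L := hw.trans (min_le_left _ _)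
  have hwin : CW * w₀ ≤ 1 / 2 := by
    have h1 : w₀ ≤ 1 / (2 * CW) := hw.trans (min_le_right _ _)
    rw [le_div_iff₀ (by positivity)] at h1
    linarith
  have hlo : ∀ (N : ℕ) (x : Tor (fine N (kingU d L e))), -w₀ ≤ v N x := fun N x => (abs_le.mp (hv N x)).1
  have hB : IsUnit (fineOpPot (L ^ k) (kingU d L e) (aK a L k) (((L ^ k : ℕ) : ℝ) ^ 2) m2 (v (L ^ k))) :=
    fineOpPot_isUnit hak.le hm.le (hlo (L ^ k)) (by
      obtain ⟨-, -, hgap, -⟩ := gap_unif (d := d) ha hL hk1 hwbar'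
      have hP : 0 ≤ (2 * ((d + 1 : ℕ) : ℝ) + aK a L k) * (4 * kapCT (d + 1) a L) ^ 2 := by positivity
      linarith)
  have hB' : IsUnit (fineOpPot (L ^ 1 * L ^ k) (kingU d L e) (aK a L (k + 1)) (((L ^ 1 * L ^ k : ℕ) : ℝ) ^ 2) m2 (v (L ^ 1 * L ^ k))) :=
    fineOpPot_isUnit hak'.le hm.le (hlo (L ^ 1 * L ^ k)) (by
      obtain ⟨-, -, hgap, -⟩ := gap_unif (d := d) ha hL (by omega : 1 ≤ k + 1) hwbar'
      have hP : 0 ≤ (2 * ((d + 1 : ℕ) : ℝ) + aK a L (k + 1)) * (4 * kapCT (d + 1) a L) ^ 2 := by positivity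
      linarith)
  have hwk : ∀ y, |v (L ^ k) y| ≤ w₀ := hv (L ^ k)
  have hwk' : ∀ y', |v (L ^ 1 * L ^ k) y'| ≤ w₀ := hv (L ^ 1 * L ^ k)
  -- the weighted letters of the undressed propagator at `δ′`
  have hmassW : ∀ x : Tor (fine (L ^ k) (kingU d L e)), (((L ^ k : ℕ) : ℝ) ^ (d + 1))⁻¹ *
      ∑ y, |constrainedProp (L ^ k) (kingU d L e) (aK a L k) (((L ^ k : ℕ) : ℝ) ^ 2) m2 x y|
        * Real.exp (δ' * tdistT (kingU d L e) (blockOf (L ^ k) (kingU d L e) x) (blockOf (L ^ k) (kingU d L e) y)) ≤ CW :=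
    fun x => HW k hk1 δ' hδ0 hδ1W (L ^ k) rfl (e + 1) (kingU d L e) hM' m2 hm le_rfl x
  have hmassW' : ∀ x' : Tor (fine (L ^ 1 * L ^ k) (kingU d L e)), (((L ^ 1 * L ^ k : ℕ) : ℝ) ^ (d + 1))⁻¹ *
      ∑ y', |constrainedProp (L ^ 1 * L ^ k) (kingU d L e) (aK a L (k + 1)) (((L ^ 1 * L ^ k : ℕ) : ℝ) ^ 2) m2 x' y'|
        * Real.exp (δ' * tdistT (kingU d L e) (blockOf (L ^ 1 * L ^ k) (kingU d L e) x') (blockOf (L ^ 1 * L ^ k) (kingU d L e) y'))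
        ≤ CW :=
    fun x' => HW (k + 1) (by omega) δ' hδ0 hδ1W (L ^ 1 * L ^ k) hN' (e + 1) (kingU d L e) hM' m2 hm le_rfl x'
  have hrateW : ∀ x' : Tor (fine (L ^ 1 * L ^ k) (kingU d L e)), (((L ^ 1 * L ^ k : ℕ) : ℝ) ^ (d + 1))⁻¹ *
      ∑ y', |constrainedProp (L ^ 1 * L ^ k) (kingU d L e) (aK a L (k + 1)) (((L ^ 1 * L ^ k : ℕ) : ℝ) ^ 2) m2 x' y'
        - constrainedProp (L ^ k) (kingU d L e) (aK a L k) (((L ^ k : ℕ) : ℝ) ^ 2) m2 (underPtN L k 1 (kingU d L e) x')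
          (underPtN L k 1 (kingU d L e) y')|
        * Real.exp (δ' * tdistT (kingU d L e) (blockOf (L ^ 1 * L ^ k) (kingU d L e) x') (blockOf (L ^ 1 * L ^ k) (kingU d L e) y'))
        ≤ CR * r ^ k := fun x' => by
    have h := HR k hk1 δ' hδ0 hδ1R 1 le_rfl (e + 1) (kingU d L e) hM' m2 hm le_rfl x'
    simpa only [blockOf_underPtN] using h
  have h := dressedProp_riemannRateW_le L hak.le hak'.le hm hB hB' hCW.le (by positivity : 0 ≤ CR * r ^ k) hδ0
    hmassW hmassW' hrateW hwk hwk' (hcoh k hk1) hwin x'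
  refine h.trans ?_
  -- bookkeeping: `2(R + R·w₀·2C_W + C_W·ν·2C_W) ≤ c·(r^k + ν₀s^k)` with `R = C_R r^k`, `ν = ν₀s^k`, `2w₀C_W ≤ 1`
  have hνs : 0 ≤ ν₀ * s ^ k := by positivity
  have hrk : 0 ≤ r ^ k := pow_nonneg hr0 k
  have h1 : CR * r ^ k * (w₀ * (2 * CW)) ≤ CR * r ^ k := by
    have : w₀ * (2 * CW) ≤ 1 := by nlinarith
    exact mul_le_of_le_one_right (by positivity) this
  have h2 : CW * (ν₀ * s ^ k * (2 * CW)) = 2 * CW ^ 2 * (ν₀ * s ^ k) := by ring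
  rw [h2]
  have h3 : 2 * (CR * r ^ k + CR * r ^ k + 2 * CW ^ 2 * (ν₀ * s ^ k)) ≤ c * (r ^ k + ν₀ * s ^ k) := by
    rw [hcdef]
    nlinarith [mul_nonneg hCR.le hrk, mul_nonneg (sq_nonneg CW) hνs, mul_nonneg hCR.le hνs, mul_nonneg (sq_nonneg CW) hrk]
  nlinarith [h1, h3]

end Run

end Summit.QuantumFields.YangMills.BalabanUVNodes.N15.KingModel
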